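import Summits.HodgeConjecture.HodgeConjecture.Theorems.CYFormCasimirCYFormCarrierEightHodgeStar
import HarnessLib

/-!
# Crux X1 `CYFormCarrierEight` (route `CYFormCasimir`, stmt-HodgeConjecture-23493), helper file 15:
# the duality operators in an arbitrary Weil frame — `s₊ w_I = c_I w^*_{Iᶜ}`, `s₋ w^*_K = c'_K w_{Kᶜ}`, `s₋ s₊` diagonal

research route conditional on HC_CM; not a corollary. Nothing here proves HC, HC_CM, the rung H2, X1 or
`stub_cyform_exists`; step S2 of `Cruxes/CYFormCarrierEight/STUB-PLAN-stub_cyform_exists.md`.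

Throughout, `s₊` is ANY `ℂ`-linear operator on `H⁴(A(ℂ); ℂ)` with `s₊(⋀⁴W) ⊆ ⋀⁴W^*` and the defining identity
`tr((z ∪ s₊ x) ∪ h_K⁴) = tr((z ∪ x) ∪ v)` (`x, z ∈ ⋀⁴W`) of helper file 14, and `s₋` likewise with `v'`; `b = (w, w^*)` is
ANY Weil frame (helper file 12). Proved:
* `monB_frame_top_mem_weilClassesPlus/Minus` — `w₁ ∪ ⋯ ∪ w₈ ∈ ⋀⁸W`, `w^*₁ ∪ ⋯ ∪ w^*₈ ∈ ⋀⁸W^*`;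
* `tri_frame_compl_ne_zero`, `tri'_frame_compl_ne_zero` — `tr((w_{Iᶜ} ∪ w_I) ∪ v) ≠ 0` for `0 ≠ v ∈ ⋀⁸W^*` and
  `tr((w^*_{Kᶜ} ∪ w^*_K) ∪ v') ≠ 0` for `0 ≠ v' ∈ ⋀⁸W` (helper file 11 in a general frame);
* `starPlus_apply_frame` — **`s₊ w_I = (tr((w_{Iᶜ} ∪ w_I) ∪ v) / tr((w_{Iᶜ} ∪ w^*_{Iᶜ}) ∪ h_K⁴)) · w^*_{Iᶜ}`**;
  `starMinus_apply_frame` — **`s₋ w^*_K = (tr((w^*_{Kᶜ} ∪ w^*_K) ∪ v') / tr((w^*_{Kᶜ} ∪ w_{Kᶜ}) ∪ h_K⁴)) · w_{Kᶜ}`**;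
  in particular the operators of helper file 14 are UNIQUE on `⋀⁴W` resp. `⋀⁴W^*`;
* `starMinus_starPlus_apply_frame` — `s₋(s₊ w_I) = λ_I · w_I` with `λ_I ≠ 0` when `v ∈ ⋀⁸W^* ∖ 0`, `v' ∈ ⋀⁸W ∖ 0`
  (`starMinus_starPlus_coeff_ne_zero`).

References: FriedmanLaza2013 (§3.5 Lemma 36), vanGeemen1994HodgeAV (proof of Thm. 6.12), LangeBirkenhake1992 (Lemma 1.1.17).
-/

-- `Summit.HodgeConjecture.HodgeConjecture.…` is the tree's mandated summit/problem namespace (single-problem summit).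
set_option linter.dupNamespace false
noncomputable section

open CategoryTheory
open Literature.AlgebraicTopology.SingularHomology
open Literature.AlgebraicGeometry.Motives
open Literature.AlgebraicGeometry.HodgeTheory
open Literature.AlgebraicGeometry.VanGeemen1994

namespace Summit.HodgeConjecture.HodgeConjecture.Theorems.CYFormCarrier

section Matrix

variable {A : AbelianVariety ℂ} {d : ℕ} {φ : A ⟶ A}
variable (hd : 0 < d) (hA : A.dim = 2 * 4) (hφ : φ ≫ φ = -(d • 𝟙 A))
  (e : ProjectiveEmbedding A.X) {a : complexBetti (projectiveSpace e.n ℂ) 2} (ha : IsRationalClass a)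
  (ha0 : a ≠ 0) (w : Module.Basis (Fin (2 * 4)) ℂ (eigW A φ d))
  (b : Module.Basis (Fin (2 * 4 + 2 * 4)) ℂ (complexBetti A.X 1))
  (hb : b = weilBasis (m := 2 * 4 - 1) (k := 2 * 4) (by omega) (by omega) hd hφ e ha ha0 w)

/-! ## §1 The top monomials of a general frame -/

/-- `topPlusIdx = castAdd(univ)`. [folklore] -/
theorem topPlusIdx_eq_map : topPlusIdx (2 * 4) = Set.powersetCard.map (2 * 4) (Fin.castAddEmb (2 * 4))
    (Set.powersetCard.ofCard (s := (Finset.univ : Finset (Fin (2 * 4)))) (by rw [Finset.card_univ, Fintype.card_fin])) :=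
  Subtype.ext rfl

/-- `topMinusIdx = natAdd(univ)`. [folklore] -/
theorem topMinusIdx_eq_map : topMinusIdx (2 * 4) = Set.powersetCard.map (2 * 4) (Fin.natAddEmb (2 * 4))
    (Set.powersetCard.ofCard (s := (Finset.univ : Finset (Fin (2 * 4)))) (by rw [Finset.card_univ, Fintype.card_fin])) :=
  Subtype.ext rfl

include hb in
/-- **`w₁ ∪ ⋯ ∪ w₈ ∈ ⋀⁸W`** in any frame. [cite: vanGeemen1994HodgeAV, proof of Thm. 6.12] -/
theorem monB_frame_top_mem_weilClassesPlus : monB b (2 * 4) (topPlusIdx (2 * 4)) ∈ weilClassesPlus A φ 4 d := by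
  classical
  rw [mem_weilClassesPlus_iff]
  intro x y
  have h := testOp_monB_frame hd hA hφ e ha ha0 w b hb x y (2 * 4) (topPlusIdx (2 * 4))
  have h0 : (Finset.univ.filter fun j : Fin (2 * 4) ↦ Fin.natAdd (2 * 4) j ∈ (topPlusIdx (2 * 4)).val).card = 0 := by
    rw [topPlusIdx_eq_map]; exact filter_natAdd_card_map_castAddEmb _
  have hp : (projW (topPlusIdx (2 * 4)).val).card = 2 * 4 := by
    have := CYFormSquare.card_eq_card_projW_add (topPlusIdx (2 * 4)).val
    rw [h0, add_zero, Set.powersetCard.card_eq] at this; exact this.symm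
  rw [h0, hp, pow_zero, mul_one] at h
  exact h

include hb in
/-- **`w^*₁ ∪ ⋯ ∪ w^*₈ ∈ ⋀⁸W^*`** in any frame. [cite: vanGeemen1994HodgeAV, proof of Thm. 6.12] -/
theorem monB_frame_top_mem_weilClassesMinus : monB b (2 * 4) (topMinusIdx (2 * 4)) ∈ weilClassesMinus A φ 4 d := by
  classical
  rw [mem_weilClassesMinus_iff]
  intro x y
  have h := testOp_monB_frame hd hA hφ e ha ha0 w b hb x y (2 * 4) (topMinusIdx (2 * 4))
  have h0 : (projW (topMinusIdx (2 * 4)).val).card = 0 := by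
    rw [topMinusIdx_eq_map]; exact projW_card_map_natAddEmb _
  have hq : (Finset.univ.filter fun j : Fin (2 * 4) ↦ Fin.natAdd (2 * 4) j ∈ (topMinusIdx (2 * 4)).val).card = 2 * 4 := by
    have := CYFormSquare.card_eq_card_projW_add (topMinusIdx (2 * 4)).val
    rw [h0, zero_add, Set.powersetCard.card_eq] at this; exact this.symm
  rw [h0, hq, pow_zero, one_mul] at h
  exact h

/-- `ℓ(b_top) ≠ 0` for the full monomial of any frame. [cite: LangeBirkenhake1992, Exercise 1.1.6 (8)] -/
theorem topCoord_monB_top_ne_zero (hA : A.dim = 2 * 4) (T : Set.powersetCard (Fin (2 * 4 + 2 * 4)) (2 + 2 * 7)) :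
    topCoord (dim_eq_seven_add_one hA) (monB b (2 + 2 * 7) T) ≠ 0 := by
  intro h0
  have h := topCoord_smul_topGen (dim_eq_seven_add_one hA) (monB b (2 + 2 * 7) T)
  rw [h0, zero_smul] at h
  exact (Module.Basis.ne_zero (monB b (2 + 2 * 7)) T) h.symm

/-- The two top index sets are disjoint with union of cardinality `16`. [folklore] -/
theorem card_topPlusIdx_union_topMinusIdx :
    ((topPlusIdx (2 * 4)).val ∪ (topMinusIdx (2 * 4)).val).card = 2 + 2 * 7 := by
  have hdisj : Disjoint (topPlusIdx (2 * 4)).val (topMinusIdx (2 * 4)).val := by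
    rw [topPlusIdx_eq_map, topMinusIdx_eq_map]; exact disjoint_map_castAddEmb_map_natAddEmb _ _
  rw [Finset.card_union_of_disjoint hdisj, Set.powersetCard.card_eq, Set.powersetCard.card_eq]

include hb hd hA hφ in
/-- **`tr((w_{Iᶜ} ∪ w_I) ∪ v) ≠ 0`** for `0 ≠ v ∈ ⋀⁸W^*`, in any frame: `w_{Iᶜ} ∪ w_I = ± (w₁ ∪ ⋯ ∪ w₈)`, `v = c · (w^*₁ ∪ ⋯ ∪ w^*₈)`,
and the product of the two tops is `±` the full monomial. [cite: vanGeemen1994HodgeAV, proof of Thm. 6.12] [cite: LangeBirkenhake1992, Lemma 1.1.17] -/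
theorem tri_frame_compl_ne_zero (hqk : 2 * 2 + 2 * 2 = Fintype.card (Fin (2 * 4)))
    (I : Set.powersetCard (Fin (2 * 4)) (2 * 2)) {v : complexBetti A.X (2 * 4)}
    (hv : v ∈ weilClassesMinus A φ 4 d) (hv0 : v ≠ 0) :
    topCoord (dim_eq_seven_add_one hA)
        (cupProduct (show 2 * 4 + 2 * 4 = 2 + 2 * 7 from rfl)
          (cupProduct (show 2 * 2 + 2 * 2 = 2 * 4 from rfl)
            (monB b (2 * 2) (Set.powersetCard.map (2 * 2) (Fin.castAddEmb (2 * 4)) (Set.powersetCard.compl hqk I)))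
            (monB b (2 * 2) (Set.powersetCard.map (2 * 2) (Fin.castAddEmb (2 * 4)) I)))
          v) ≠ 0 := by
  classical
  have hdisj : Disjoint (Set.powersetCard.map (2 * 2) (Fin.castAddEmb (2 * 4)) (Set.powersetCard.compl hqk I)).val
      (Set.powersetCard.map (2 * 2) (Fin.castAddEmb (2 * 4)) I).val := by
    rw [Set.powersetCard.val_map, Set.powersetCard.val_map, Finset.disjoint_left]
    rintro p hp hp'
    obtain ⟨i, hi, rfl⟩ := Finset.mem_map.1 hp
    obtain ⟨i', hi', hii'⟩ := Finset.mem_map.1 hp'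
    rw [(Fin.castAddEmb (2 * 4)).injective hii'] at hi'
    rw [Set.powersetCard.coe_compl, Finset.mem_compl] at hi
    exact hi hi'
  have hunion : (topPlusIdx (2 * 4)).val =
      (Set.powersetCard.map (2 * 2) (Fin.castAddEmb (2 * 4)) (Set.powersetCard.compl hqk I)).val ∪
        (Set.powersetCard.map (2 * 2) (Fin.castAddEmb (2 * 4)) I).val := by
    rw [Set.powersetCard.val_map, Set.powersetCard.val_map, Set.powersetCard.coe_compl, ← Finset.map_union]
    change (Finset.univ : Finset (Fin (2 * 4))).map (Fin.castAddEmb (2 * 4)) = _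
    congr 1
    rw [Finset.union_comm, Finset.union_compl]
  obtain ⟨ε₁, hε₁, h₁⟩ := cupProduct_monB_monB_of_disjoint b (show 2 * 2 + 2 * 2 = 2 * 4 from rfl) _ _
    (topPlusIdx (2 * 4)) hdisj hunion
  -- `v = c • T₋`
  have hΛ := hasExteriorCohomologyH1 A
  have hb₁ : Module.finrank ℂ (complexBetti A.X 1) = 2 * (2 * 4) := by
    rw [abelianVarietyCohomologyExteriorH1_holds.finrank_one A, hA]
  have hTM := monB_frame_top_mem_weilClassesMinus hd hA hφ e ha ha0 w b hb
  have hTM0 : monB b (2 * 4) (topMinusIdx (2 * 4)) ≠ 0 := Module.Basis.ne_zero _ _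
  obtain ⟨c, hc⟩ := Submodule.mem_span_singleton.1 (weilClassesMinus_le_span_singleton hΛ hb₁ hd hφ hTM hTM0 hv)
  have hc0 : c ≠ 0 := by rintro rfl; exact hv0 (by rw [← hc, zero_smul])
  set T : Set.powersetCard (Fin (2 * 4 + 2 * 4)) (2 + 2 * 7) := Set.powersetCard.ofCard card_topPlusIdx_union_topMinusIdx
    with hT
  have hdisj2 : Disjoint (topPlusIdx (2 * 4)).val (topMinusIdx (2 * 4)).val := by
    rw [topPlusIdx_eq_map, topMinusIdx_eq_map]; exact disjoint_map_castAddEmb_map_natAddEmb _ _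
  obtain ⟨ε₂, hε₂, h₂⟩ := cupProduct_monB_monB_of_disjoint b (show 2 * 4 + 2 * 4 = 2 + 2 * 7 from rfl)
    (topPlusIdx (2 * 4)) (topMinusIdx (2 * 4)) T hdisj2 rfl
  rw [h₁, ← hc, LinearMap.map_smul₂, map_smul, map_smul, map_smul, h₂, map_smul, smul_eq_mul, smul_eq_mul, smul_eq_mul]
  have hε₁0 : ε₁ ≠ 0 := fun h ↦ by rw [h, mul_zero] at hε₁; exact zero_ne_one hε₁
  have hε₂0 : ε₂ ≠ 0 := fun h ↦ by rw [h, mul_zero] at hε₂; exact zero_ne_one hε₂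
  exact mul_ne_zero hε₁0 (mul_ne_zero hc0 (mul_ne_zero hε₂0 (topCoord_monB_top_ne_zero b hA T)))

include hb hd hA hφ in
/-- **`tr((w^*_{Kᶜ} ∪ w^*_K) ∪ v') ≠ 0`** for `0 ≠ v' ∈ ⋀⁸W`, in any frame. [cite: vanGeemen1994HodgeAV, proof of Thm. 6.12]
[cite: LangeBirkenhake1992, Lemma 1.1.17] -/
theorem tri'_frame_compl_ne_zero (hqk : 2 * 2 + 2 * 2 = Fintype.card (Fin (2 * 4)))
    (K : Set.powersetCard (Fin (2 * 4)) (2 * 2)) {v' : complexBetti A.X (2 * 4)}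
    (hv' : v' ∈ weilClassesPlus A φ 4 d) (hv0 : v' ≠ 0) :
    topCoord (dim_eq_seven_add_one hA)
        (cupProduct (show 2 * 4 + 2 * 4 = 2 + 2 * 7 from rfl)
          (cupProduct (show 2 * 2 + 2 * 2 = 2 * 4 from rfl)
            (monB b (2 * 2) (Set.powersetCard.map (2 * 2) (Fin.natAddEmb (2 * 4)) (Set.powersetCard.compl hqk K)))
            (monB b (2 * 2) (Set.powersetCard.map (2 * 2) (Fin.natAddEmb (2 * 4)) K)))
          v') ≠ 0 := by
  classical
  have hdisj : Disjoint (Set.powersetCard.map (2 * 2) (Fin.natAddEmb (2 * 4)) (Set.powersetCard.compl hqk K)).val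
      (Set.powersetCard.map (2 * 2) (Fin.natAddEmb (2 * 4)) K).val := by
    rw [Set.powersetCard.val_map, Set.powersetCard.val_map, Finset.disjoint_left]
    rintro p hp hp'
    obtain ⟨i, hi, rfl⟩ := Finset.mem_map.1 hp
    obtain ⟨i', hi', hii'⟩ := Finset.mem_map.1 hp'
    rw [(Fin.natAddEmb (2 * 4)).injective hii'] at hi'
    rw [Set.powersetCard.coe_compl, Finset.mem_compl] at hi
    exact hi hi'
  have hunion : (topMinusIdx (2 * 4)).val =
      (Set.powersetCard.map (2 * 2) (Fin.natAddEmb (2 * 4)) (Set.powersetCard.compl hqk K)).val ∪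
        (Set.powersetCard.map (2 * 2) (Fin.natAddEmb (2 * 4)) K).val := by
    rw [Set.powersetCard.val_map, Set.powersetCard.val_map, Set.powersetCard.coe_compl, ← Finset.map_union]
    change (Finset.univ : Finset (Fin (2 * 4))).map (Fin.natAddEmb (2 * 4)) = _
    congr 1
    rw [Finset.union_comm, Finset.union_compl]
  obtain ⟨ε₁, hε₁, h₁⟩ := cupProduct_monB_monB_of_disjoint b (show 2 * 2 + 2 * 2 = 2 * 4 from rfl) _ _
    (topMinusIdx (2 * 4)) hdisj hunion
  have hΛ := hasExteriorCohomologyH1 A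
  have hb₁ : Module.finrank ℂ (complexBetti A.X 1) = 2 * (2 * 4) := by
    rw [abelianVarietyCohomologyExteriorH1_holds.finrank_one A, hA]
  have hTP := monB_frame_top_mem_weilClassesPlus hd hA hφ e ha ha0 w b hb
  have hTP0 : monB b (2 * 4) (topPlusIdx (2 * 4)) ≠ 0 := Module.Basis.ne_zero _ _
  obtain ⟨c, hc⟩ := Submodule.mem_span_singleton.1 (weilClassesPlus_le_span_singleton hΛ hb₁ hd hφ hTP hTP0 hv')
  have hc0 : c ≠ 0 := by rintro rfl; exact hv0 (by rw [← hc, zero_smul])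
  have hcardT : ((topMinusIdx (2 * 4)).val ∪ (topPlusIdx (2 * 4)).val).card = 2 + 2 * 7 := by
    rw [Finset.union_comm]; exact card_topPlusIdx_union_topMinusIdx
  set T : Set.powersetCard (Fin (2 * 4 + 2 * 4)) (2 + 2 * 7) := Set.powersetCard.ofCard hcardT with hT
  have hdisj2 : Disjoint (topMinusIdx (2 * 4)).val (topPlusIdx (2 * 4)).val := by
    rw [topPlusIdx_eq_map, topMinusIdx_eq_map]; exact (disjoint_map_castAddEmb_map_natAddEmb _ _).symm
  obtain ⟨ε₂, hε₂, h₂⟩ := cupProduct_monB_monB_of_disjoint b (show 2 * 4 + 2 * 4 = 2 + 2 * 7 from rfl)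
    (topMinusIdx (2 * 4)) (topPlusIdx (2 * 4)) T hdisj2 rfl
  rw [h₁, ← hc, LinearMap.map_smul₂, map_smul, map_smul, map_smul, h₂, map_smul, smul_eq_mul, smul_eq_mul, smul_eq_mul]
  have hε₁0 : ε₁ ≠ 0 := fun h ↦ by rw [h, mul_zero] at hε₁; exact zero_ne_one hε₁
  have hε₂0 : ε₂ ≠ 0 := fun h ↦ by rw [h, mul_zero] at hε₂; exact zero_ne_one hε₂
  exact mul_ne_zero hε₁0 (mul_ne_zero hc0 (mul_ne_zero hε₂0 (topCoord_monB_top_ne_zero b hA T)))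

/-! ## §2 The matrix of `s₊`, `s₋` in a general frame -/

include hb hd hA hφ e ha ha0 in
/-- **`s₊ w_I = c_I · w^*_{Iᶜ}`** with `c_I = tr((w_{Iᶜ} ∪ w_I) ∪ v) / tr((w_{Iᶜ} ∪ w^*_{Iᶜ}) ∪ h_K⁴)`, for ANY operator `s₊` with
`s₊(⋀⁴W) ⊆ ⋀⁴W^*` satisfying the defining identity, in ANY frame: the `w^*_K`-coordinate of `s₊ w_I ∈ ⋀⁴W^*` is read off from
`β(w_K, s₊ w_I) = tr((w_K ∪ w_I) ∪ v)`, which vanishes unless `K = Iᶜ`. [cite: FriedmanLaza2013, §3.5 Lemma 36]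
[cite: vanGeemen1994HodgeAV, proof of Thm. 6.12] -/
theorem starPlus_apply_frame (hSU : HasHodgeGroupSU A φ 4 d (hK d φ e a))
    (hqk : 2 * 2 + 2 * 2 = Fintype.card (Fin (2 * 4))) (v : complexBetti A.X (2 * 4))
    (S : complexBetti A.X (2 * 2) →ₗ[ℂ] complexBetti A.X (2 * 2))
    (hS1 : ∀ x ∈ weilClassesPlus A φ 2 d, S x ∈ weilClassesMinus A φ 2 d)
    (hS2 : ∀ x ∈ weilClassesPlus A φ 2 d, ∀ z ∈ weilClassesPlus A φ 2 d,
      topCoord (dim_eq_seven_add_one hA)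
          (cupProduct (show 2 * 4 + 2 * 4 = 2 + 2 * 7 from rfl)
            (cupProduct (show 2 * 2 + 2 * 2 = 2 * 4 from rfl) z (S x)) (cupPowTwo (hK d φ e a) 4)) =
        topCoord (dim_eq_seven_add_one hA)
          (cupProduct (show 2 * 4 + 2 * 4 = 2 + 2 * 7 from rfl)
            (cupProduct (show 2 * 2 + 2 * 2 = 2 * 4 from rfl) z x) v))
    (I : Set.powersetCard (Fin (2 * 4)) (2 * 2)) :
    S (monB b (2 * 2) (Set.powersetCard.map (2 * 2) (Fin.castAddEmb (2 * 4)) I)) =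
      (topCoord (dim_eq_seven_add_one hA)
          (cupProduct (show 2 * 4 + 2 * 4 = 2 + 2 * 7 from rfl)
            (cupProduct (show 2 * 2 + 2 * 2 = 2 * 4 from rfl)
              (monB b (2 * 2) (Set.powersetCard.map (2 * 2) (Fin.castAddEmb (2 * 4)) (Set.powersetCard.compl hqk I)))
              (monB b (2 * 2) (Set.powersetCard.map (2 * 2) (Fin.castAddEmb (2 * 4)) I))) v) /
        topCoord (dim_eq_seven_add_one hA)
          (cupProduct (show 2 * 4 + 2 * 4 = 2 + 2 * 7 from rfl)
            (cupProduct (show 2 * 2 + 2 * 2 = 2 * 4 from rfl)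
              (monB b (2 * 2) (Set.powersetCard.map (2 * 2) (Fin.castAddEmb (2 * 4)) (Set.powersetCard.compl hqk I)))
              (monB b (2 * 2) (Set.powersetCard.map (2 * 2) (Fin.natAddEmb (2 * 4)) (Set.powersetCard.compl hqk I))))
            (cupPowTwo (hK d φ e a) 4))) •
      monB b (2 * 2) (Set.powersetCard.map (2 * 2) (Fin.natAddEmb (2 * 4)) (Set.powersetCard.compl hqk I)) := by
  classical
  set B := monB b (2 * 2) with hB
  set x := monB b (2 * 2) (Set.powersetCard.map (2 * 2) (Fin.castAddEmb (2 * 4)) I) with hx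
  have hxP : x ∈ weilClassesPlus A φ 2 d := monB_frame_castAdd_mem_weilClassesPlus hd hA hφ e ha ha0 w b hb I
  have hy : S x ∈ weilClassesMinus A φ 2 d := hS1 x hxP
  -- coordinates of `S x`
  have hcoord : ∀ K, B.repr (S x) (Set.powersetCard.map (2 * 2) (Fin.natAddEmb (2 * 4)) K) *
      topCoord (dim_eq_seven_add_one hA)
        (cupProduct (show 2 * 4 + 2 * 4 = 2 + 2 * 7 from rfl)
          (cupProduct (show 2 * 2 + 2 * 2 = 2 * 4 from rfl)
            (monB b (2 * 2) (Set.powersetCard.map (2 * 2) (Fin.castAddEmb (2 * 4)) K))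
            (monB b (2 * 2) (Set.powersetCard.map (2 * 2) (Fin.natAddEmb (2 * 4)) K)))
          (cupPowTwo (hK d φ e a) 4)) =
      topCoord (dim_eq_seven_add_one hA)
        (cupProduct (show 2 * 4 + 2 * 4 = 2 + 2 * 7 from rfl)
          (cupProduct (show 2 * 2 + 2 * 2 = 2 * 4 from rfl)
            (monB b (2 * 2) (Set.powersetCard.map (2 * 2) (Fin.castAddEmb (2 * 4)) K)) x) v) := by
    intro K
    rw [← beta_row_frame hd hA hφ e ha ha0 w b hb hSU K hy]
    exact hS2 x hxP _ (monB_frame_castAdd_mem_weilClassesPlus hd hA hφ e ha ha0 w b hb K)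
  have hzero : ∀ s, s ≠ Set.powersetCard.map (2 * 2) (Fin.natAddEmb (2 * 4)) (Set.powersetCard.compl hqk I) →
      B.repr (S x) s = 0 := by
    intro s hs
    by_cases hs0 : (projW s.val).card = 0
    · obtain ⟨K, rfl⟩ := exists_eq_map_natAddEmb s hs0
      have hK : K ≠ Set.powersetCard.compl hqk I := fun h ↦ hs (by rw [h])
      have h := hcoord K
      rw [hx, cup_frame_castAdd_eq_zero_of_ne_compl b hqk I K hK, LinearMap.map_zero₂, map_zero] at h
      exact (mul_eq_zero.1 h).resolve_right (beta_frame_diag_ne_zero hd hA hφ e ha ha0 w b hb hSU K)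
    · exact repr_frame_eq_zero_of_mem_weilClassesMinus_two hd hA hφ e ha ha0 w b hb hy s hs0
  have hmain := hcoord (Set.powersetCard.compl hqk I)
  have hne := beta_frame_diag_ne_zero hd hA hφ e ha ha0 w b hb hSU (Set.powersetCard.compl hqk I)
  conv_lhs => rw [← B.sum_repr (S x)]
  rw [Finset.sum_eq_single (Set.powersetCard.map (2 * 2) (Fin.natAddEmb (2 * 4)) (Set.powersetCard.compl hqk I))
    (fun s _ hs ↦ by rw [hzero s hs, zero_smul]) (fun h ↦ absurd (Finset.mem_univ _) h)]
  congr 1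
  rw [eq_div_iff hne, hmain]

include hb hd hA hφ e ha ha0 in
/-- **`s₋ w^*_K = c'_K · w_{Kᶜ}`** with `c'_K = tr((w^*_{Kᶜ} ∪ w^*_K) ∪ v') / tr((w^*_{Kᶜ} ∪ w_{Kᶜ}) ∪ h_K⁴)`, for ANY `s₋` with
`s₋(⋀⁴W^*) ⊆ ⋀⁴W` satisfying the defining identity, in ANY frame. [cite: FriedmanLaza2013, §3.5 Lemma 36]
[cite: vanGeemen1994HodgeAV, proof of Thm. 6.12] -/
theorem starMinus_apply_frame (hSU : HasHodgeGroupSU A φ 4 d (hK d φ e a))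
    (hqk : 2 * 2 + 2 * 2 = Fintype.card (Fin (2 * 4))) (v' : complexBetti A.X (2 * 4))
    (S' : complexBetti A.X (2 * 2) →ₗ[ℂ] complexBetti A.X (2 * 2))
    (hS1 : ∀ y ∈ weilClassesMinus A φ 2 d, S' y ∈ weilClassesPlus A φ 2 d)
    (hS2 : ∀ y ∈ weilClassesMinus A φ 2 d, ∀ z' ∈ weilClassesMinus A φ 2 d,
      topCoord (dim_eq_seven_add_one hA)
          (cupProduct (show 2 * 4 + 2 * 4 = 2 + 2 * 7 from rfl)
            (cupProduct (show 2 * 2 + 2 * 2 = 2 * 4 from rfl) z' (S' y)) (cupPowTwo (hK d φ e a) 4)) =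
        topCoord (dim_eq_seven_add_one hA)
          (cupProduct (show 2 * 4 + 2 * 4 = 2 + 2 * 7 from rfl)
            (cupProduct (show 2 * 2 + 2 * 2 = 2 * 4 from rfl) z' y) v'))
    (K : Set.powersetCard (Fin (2 * 4)) (2 * 2)) :
    S' (monB b (2 * 2) (Set.powersetCard.map (2 * 2) (Fin.natAddEmb (2 * 4)) K)) =
      (topCoord (dim_eq_seven_add_one hA)
          (cupProduct (show 2 * 4 + 2 * 4 = 2 + 2 * 7 from rfl)
            (cupProduct (show 2 * 2 + 2 * 2 = 2 * 4 from rfl)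
              (monB b (2 * 2) (Set.powersetCard.map (2 * 2) (Fin.natAddEmb (2 * 4)) (Set.powersetCard.compl hqk K)))
              (monB b (2 * 2) (Set.powersetCard.map (2 * 2) (Fin.natAddEmb (2 * 4)) K))) v') /
        topCoord (dim_eq_seven_add_one hA)
          (cupProduct (show 2 * 4 + 2 * 4 = 2 + 2 * 7 from rfl)
            (cupProduct (show 2 * 2 + 2 * 2 = 2 * 4 from rfl)
              (monB b (2 * 2) (Set.powersetCard.map (2 * 2) (Fin.natAddEmb (2 * 4)) (Set.powersetCard.compl hqk K)))
              (monB b (2 * 2) (Set.powersetCard.map (2 * 2) (Fin.castAddEmb (2 * 4)) (Set.powersetCard.compl hqk K))))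
            (cupPowTwo (hK d φ e a) 4))) •
      monB b (2 * 2) (Set.powersetCard.map (2 * 2) (Fin.castAddEmb (2 * 4)) (Set.powersetCard.compl hqk K)) := by
  classical
  set B := monB b (2 * 2) with hB
  set y := monB b (2 * 2) (Set.powersetCard.map (2 * 2) (Fin.natAddEmb (2 * 4)) K) with hydef
  have hyM : y ∈ weilClassesMinus A φ 2 d := monB_frame_natAdd_mem_weilClassesMinus hd hA hφ e ha ha0 w b hb K
  have hx : S' y ∈ weilClassesPlus A φ 2 d := hS1 y hyM
  -- `β` in the order `(w^*, w)` equals `β`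
  have hcomm : ∀ L (t : complexBetti A.X (2 * 2)), topCoord (dim_eq_seven_add_one hA)
      (cupProduct (show 2 * 4 + 2 * 4 = 2 + 2 * 7 from rfl)
        (cupProduct (show 2 * 2 + 2 * 2 = 2 * 4 from rfl)
          (monB b (2 * 2) (Set.powersetCard.map (2 * 2) (Fin.natAddEmb (2 * 4)) L)) t) (cupPowTwo (hK d φ e a) 4)) =
      topCoord (dim_eq_seven_add_one hA)
      (cupProduct (show 2 * 4 + 2 * 4 = 2 + 2 * 7 from rfl)
        (cupProduct (show 2 * 2 + 2 * 2 = 2 * 4 from rfl) t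
          (monB b (2 * 2) (Set.powersetCard.map (2 * 2) (Fin.natAddEmb (2 * 4)) L))) (cupPowTwo (hK d φ e a) 4)) :=
    fun L t ↦ by rw [cupProduct_comm_four]
  have hcoord : ∀ L, B.repr (S' y) (Set.powersetCard.map (2 * 2) (Fin.castAddEmb (2 * 4)) L) *
      topCoord (dim_eq_seven_add_one hA)
        (cupProduct (show 2 * 4 + 2 * 4 = 2 + 2 * 7 from rfl)
          (cupProduct (show 2 * 2 + 2 * 2 = 2 * 4 from rfl)
            (monB b (2 * 2) (Set.powersetCard.map (2 * 2) (Fin.castAddEmb (2 * 4)) L))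
            (monB b (2 * 2) (Set.powersetCard.map (2 * 2) (Fin.natAddEmb (2 * 4)) L)))
          (cupPowTwo (hK d φ e a) 4)) =
      topCoord (dim_eq_seven_add_one hA)
        (cupProduct (show 2 * 4 + 2 * 4 = 2 + 2 * 7 from rfl)
          (cupProduct (show 2 * 2 + 2 * 2 = 2 * 4 from rfl)
            (monB b (2 * 2) (Set.powersetCard.map (2 * 2) (Fin.natAddEmb (2 * 4)) L)) y) v') := by
    intro L
    rw [← beta_col_frame hd hA hφ e ha ha0 w b hb hSU L hx, ← hcomm]
    exact hS2 y hyM _ (monB_frame_natAdd_mem_weilClassesMinus hd hA hφ e ha ha0 w b hb L)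
  have hzero : ∀ s, s ≠ Set.powersetCard.map (2 * 2) (Fin.castAddEmb (2 * 4)) (Set.powersetCard.compl hqk K) →
      B.repr (S' y) s = 0 := by
    intro s hs
    by_cases hs0 : (Finset.univ.filter fun j : Fin (2 * 4) ↦ Fin.natAdd (2 * 4) j ∈ s.val).card = 0
    · obtain ⟨L, rfl⟩ := exists_eq_map_castAddEmb s hs0
      have hL : L ≠ Set.powersetCard.compl hqk K := fun h ↦ hs (by rw [h])
      have h := hcoord L
      rw [hydef, cup_frame_natAdd_eq_zero_of_ne_compl b hqk K L hL, LinearMap.map_zero₂, map_zero] at h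
      exact (mul_eq_zero.1 h).resolve_right (beta_frame_diag_ne_zero hd hA hφ e ha ha0 w b hb hSU L)
    · exact repr_frame_eq_zero_of_mem_weilClassesPlus_two hd hA hφ e ha ha0 w b hb hx s hs0
  have hmain := hcoord (Set.powersetCard.compl hqk K)
  have hne : topCoord (dim_eq_seven_add_one hA)
      (cupProduct (show 2 * 4 + 2 * 4 = 2 + 2 * 7 from rfl)
        (cupProduct (show 2 * 2 + 2 * 2 = 2 * 4 from rfl)
          (monB b (2 * 2) (Set.powersetCard.map (2 * 2) (Fin.natAddEmb (2 * 4)) (Set.powersetCard.compl hqk K)))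
          (monB b (2 * 2) (Set.powersetCard.map (2 * 2) (Fin.castAddEmb (2 * 4)) (Set.powersetCard.compl hqk K))))
        (cupPowTwo (hK d φ e a) 4)) ≠ 0 := by
    rw [hcomm]; exact beta_frame_diag_ne_zero hd hA hφ e ha ha0 w b hb hSU (Set.powersetCard.compl hqk K)
  conv_lhs => rw [← B.sum_repr (S' y)]
  rw [Finset.sum_eq_single (Set.powersetCard.map (2 * 2) (Fin.castAddEmb (2 * 4)) (Set.powersetCard.compl hqk K))
    (fun s _ hs ↦ by rw [hzero s hs, zero_smul]) (fun h ↦ absurd (Finset.mem_univ _) h)]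
  congr 1
  rw [eq_div_iff hne, hcomm, hmain]

end Matrix

end Summit.HodgeConjecture.HodgeConjecture.Theorems.CYFormCarrier

end
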